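import Literature.Computability.Cryptography.IndistinguishabilityAppend
import Literature.Computability.Cryptography.IndistinguishabilityPostProcessing
import HarnessLib

/-!
# Appending an independent uniform string of advice-determined length preserves indistinguishability

Companion of `IndistinguishabilityAppend.lean` (`IsCompIndistinguishable.append_sampled`: the appended
string has a POLYNOMIAL length `a(n)`) for HILL-type mildly non-uniform constructions, where the lengths of
the pieces of a generator's output at the correct advice are polynomially bounded but not polynomial-time
computable functions of the level: if `X ≈_c Y` (level-wise length `ℓ(n)`, polynomially bounded) and
`b(n) ≤ q(n)` is ANY function, then `n ↦ X_n ‖ U_{b(n)} ≈_c n ↦ Y_n ‖ U_{b(n)}`. As in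
`IndistinguishabilityAdvicePostProcessing.lean` the number `b(n)` is handed to the (uniform) reduction
through its coin budget `κ·(q(n)+1) + b(n)` (HILL 1999, Def. 2.3.3 / §3.1: mildly non-uniform adversaries;
the tree's `RandAlg.coinLen` is an arbitrary polynomially bounded function). No new named facts.
-/

namespace Literature.Computability.Cryptography

open Filter Asymptotics Polynomial _root_.Computability Complexity Complexity.Brick Complexity.Plumb MetaComplexity
  PRGTrunc PRGPrefix

namespace AdvApp

variable (q : Polynomial ℕ)

/-- `|1ⁿ| = n`. [folklore] -/
private theorem length_unary (n : ℕ) : (unaryEncodeNat n).length = n := unary_decode_encode_nat n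

/-- `⟨1^{|r| / B}, 1^{|r| mod B}⟩`, `B = q(|u|)+1`, on `⟨⟨u, α⟩, r⟩`. [folklore] -/
noncomputable def dmF : List Bool → List Bool :=
  divModFn ∘ fanoutFn (polyFn (q + 1) ∘ fstF ∘ fstF) (onesFn ∘ sndF)

/-- The appended piece `(r ⇂ κ) ↾ b`. [folklore] -/
noncomputable def pieceF : List Bool → List Bool :=
  takeFn ∘ fanoutFn (sndF ∘ dmF q) (dropFn ∘ fanoutFn (fstF ∘ dmF q) sndF)

/-- **The query**: `⟨⟨u, α ++ (r ⇂ κ) ↾ b⟩, r ↾ κ⟩` with `⟨1^κ, 1^b⟩ = dmF`. [folklore] -/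
noncomputable def coreF : List Bool → List Bool :=
  fanoutFn (fanoutFn (fstF ∘ fstF) (fun w => (sndF ∘ fstF) w ++ pieceF q w)) (takeFn ∘ fanoutFn (fstF ∘ dmF q) sndF)

/-- `coreF ∈ FP`. [cite: AroraBarak2009, §1.3] -/
theorem coreF_mem_FP : coreF q ∈ FP := by
  have hdm : dmF q ∈ FP := comp_mem_FP divModFn_mem_FP (fanoutFn_mem_FP
    (comp_mem_FP (polyFn_mem_FP _) (comp_mem_FP fstF_mem_FP fstF_mem_FP)) (comp_mem_FP onesFn_mem_FP sndF_mem_FP))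
  have hpiece : pieceF q ∈ FP := comp_mem_FP takeFn_mem_FP (fanoutFn_mem_FP (comp_mem_FP sndF_mem_FP hdm)
    (comp_mem_FP dropFn_mem_FP (fanoutFn_mem_FP (comp_mem_FP fstF_mem_FP hdm) sndF_mem_FP)))
  exact fanoutFn_mem_FP (fanoutFn_mem_FP (comp_mem_FP fstF_mem_FP fstF_mem_FP) (append_mem_FP (comp_mem_FP sndF_mem_FP fstF_mem_FP) hpiece))
    (comp_mem_FP takeFn_mem_FP (fanoutFn_mem_FP (comp_mem_FP fstF_mem_FP hdm) sndF_mem_FP))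

/-- Value of `dmF`. [folklore] -/
theorem dmF_apply (u α r : List Bool) :
    dmF q (boolPair (boolPair u α) r) = boolPair (ones (r.length / (q.eval u.length + 1))) (ones (r.length % (q.eval u.length + 1))) := by
  simp only [dmF, Function.comp_apply, fanoutFn_apply, fstF_boolPair, sndF_boolPair, polyFn_apply, onesFn, unaryEncodeNat_eq_replicate,
    eval_add, eval_one]
  exact divModFn_boolPair _ _

/-- **Value of the query.** [folklore] -/
theorem coreF_apply (u α r : List Bool) :
    coreF q (boolPair (boolPair u α) r) =
      boolPair (boolPair u (α ++ (r.drop (r.length / (q.eval u.length + 1))).take (r.length % (q.eval u.length + 1))))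
        (r.take (r.length / (q.eval u.length + 1))) := by
  simp only [coreF, pieceF, Function.comp_apply, fanoutFn_apply, fstF_boolPair, sndF_boolPair, dmF_apply, takeFn_boolPair, dropFn_boolPair, ones,
    List.length_replicate]

/-- **The reduction** (budget `cl`). [cite: HastadImpagliazzoLevinLuby1999, §3.1 (mildly non-uniform adversary); Goldreich2001, Thm. 3.2.6 (proof, D')] -/
noncomputable def red (D : RandAlg (List Bool) Bool) (cl : ℕ → ℕ) : RandAlg (List Bool) Bool where
  run x r := D.run (fstF (coreF q (boolPair x r))) (sndF (coreF q (boolPair x r)))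
  coinLen := cl

/-- `red` is PPT. [cite: AroraBarak2009, §1.3] -/
theorem isPPT_red {D : RandAlg (List Bool) Bool} (hD : IsPPT D encodeBool) {cl : ℕ → ℕ}
    (hcl : ∃ p : Polynomial ℕ, ∀ n, cl n ≤ p.eval n) : IsPPT (red q D cl) encodeBool := by
  refine ⟨?_, hcl⟩
  exact PolyTimeComputable.of_encode_eq (f := (fun w => encodeBool (D.run (fstF w) (sndF w))) ∘ coreF q)
    (fun p : List Bool × List Bool => boolPair p.1 p.2) (fun _ => rfl) (fun _ => rfl)
    (comp_mem_FP (Hybrid.distFn_mem_FP hD) (coreF_mem_FP q))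

/-- **Output law of the reduction** on `⟨1ⁿ, α⟩` with budget `κ·(q(n)+1) + b`, `b ≤ q(n)`, `κ = coinLen_D(2n+2+|α|+b)`:
the law of `D` on `⟨1ⁿ, α ++ U_b⟩`. [cite: Goldreich2001, Claim 3.2.6.1 (m = 2)] -/
theorem outputPMF_red (D : RandAlg (List Bool) Bool) {cl : ℕ → ℕ} {n b : ℕ} {α : List Bool} (hb : b ≤ q.eval n)
    (hcl : cl (2 * n + 2 + α.length) = D.coinLen (2 * n + 2 + (α.length + b)) * (q.eval n + 1) + b) :
    (red q D cl).outputPMF id (boolPair (unaryEncodeNat n) α) =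
      ((uniformBits b).map fun s => α ++ s).bind fun h => D.outputPMF id (boolPair (unaryEncodeNat n) h) := by
  classical
  set u := unaryEncodeNat n with hu
  set κ := D.coinLen (2 * n + 2 + (α.length + b)) with hκ
  have hun : u.length = n := length_unary n
  have hB : 0 < q.eval n + 1 := Nat.succ_pos _
  have hdiv : (κ * (q.eval n + 1) + b) / (q.eval n + 1) = κ := by
    rw [Nat.add_comm, Nat.add_mul_div_right _ _ hB, Nat.div_eq_of_lt (Nat.lt_succ_of_le hb), zero_add]
  have hmod : (κ * (q.eval n + 1) + b) % (q.eval n + 1) = b := by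
    rw [Nat.add_comm, Nat.add_mul_mod_self_right, Nat.mod_eq_of_lt (Nat.lt_succ_of_le hb)]
  refine AppendSamp.pmf_bool_eq_of_toReal_true_eq ?_
  have hlenA : (red q D cl).coinLen (id (boolPair u α)).length = κ + (b + κ * q.eval n) := by
    show cl (boolPair u α).length = _
    rw [length_boolPair, hun, hcl]; ring
  have hL : ((red q D cl).outputPMF id (boolPair u α) true).toReal =
      uniformAvg κ fun rD => uniformAvg b fun s => if D.run (boolPair u (α ++ s)) rD = true then (1 : ℝ) else 0 := by
    rw [show ((red q D cl).outputPMF id (boolPair u α) true).toReal = (red q D cl).pr id (boolPair u α) {true} by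
        rw [RandAlg.pr, PMF.toOuterMeasure_apply_singleton],
      RandAlg.pr_true_eq_uniformAvg _ id _ hlenA, uniformAvg_append]
    refine uniformAvg_congr fun rD hrD => ?_
    rw [uniformAvg_append]
    refine uniformAvg_congr fun s hs => ?_
    rw [uniformAvg_congr fun w (hw : w.length = κ * q.eval n) => show (if (red q D cl).run (boolPair u α) (rD ++ (s ++ w)) = true then (1 : ℝ) else 0) =
        (if D.run (boolPair u (α ++ s)) rD = true then (1 : ℝ) else 0) from ?_, uniformAvg_const]
    have hr : (rD ++ (s ++ w)).length = κ * (q.eval n + 1) + b := by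
      rw [List.length_append, List.length_append, hrD, hs, hw]; ring
    have hrun : (red q D cl).run (boolPair u α) (rD ++ (s ++ w)) = D.run (boolPair u (α ++ s)) rD := by
      show D.run (fstF (coreF q (boolPair (boolPair u α) (rD ++ (s ++ w))))) (sndF (coreF q (boolPair (boolPair u α) (rD ++ (s ++ w))))) = _
      rw [coreF_apply, fstF_boolPair, sndF_boolPair, hun, hr, hdiv, hmod, List.drop_append_of_le_length hrD.ge,
        List.drop_of_length_le hrD.le, List.nil_append, List.take_append_of_le_length hs.ge, List.take_of_length_le hs.le,
        List.take_append_of_le_length hrD.ge, List.take_of_length_le hrD.le]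
    rw [hrun]
  have hR : ((((uniformBits b).map fun s => α ++ s).bind fun h => D.outputPMF id (boolPair u h)) true).toReal =
      uniformAvg b fun s => uniformAvg κ fun rD => if D.run (boolPair u (α ++ s)) rD = true then (1 : ℝ) else 0 := by
    rw [PMF.bind_map, bind_uniformBits_apply_toReal]
    refine uniformAvg_congr fun s hs => ?_
    rw [Function.comp_apply, show (D.outputPMF id (boolPair u (α ++ s)) true).toReal = D.pr id (boolPair u (α ++ s)) {true} by
        rw [RandAlg.pr, PMF.toOuterMeasure_apply_singleton]]
    exact RandAlg.pr_true_eq_uniformAvg D id _ (by rw [id, length_boolPair, hun, List.length_append, hs])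
  rw [hL, hR, uniformAvg_comm]

/-- **Acceptance of the reduction.** [cite: Goldreich2001, Def. 3.2.2] -/
theorem acceptPMF_red (D : RandAlg (List Bool) Bool) {cl : ℕ → ℕ} {n b : ℕ} (X : PMF (List Bool)) {ℓ : ℕ}
    (hX : ∀ s ∈ X.support, s.length = ℓ) (hb : b ≤ q.eval n)
    (hcl : cl (2 * n + 2 + ℓ) = D.coinLen (2 * n + 2 + (ℓ + b)) * (q.eval n + 1) + b) :
    acceptPMF (red q D cl) n X = acceptPMF D n (X.bind fun α => (uniformBits b).map fun s => α ++ s) := by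
  rw [acceptPMF, acceptPMF, PMF.bind_bind]
  refine pmf_bind_congr_of_mem_support X fun α hα => ?_
  rw [outputPMF_red q D hb (by rw [hX α hα]; exact hcl)]

/-- **The advice budget.** [folklore] -/
noncomputable def advCl (D : RandAlg (List Bool) Bool) (ℓ b : ℕ → ℕ) (S : Set ℕ) (len : ℕ → ℕ) (L : ℕ) : ℕ :=
  open scoped Classical in
  if ∃ n, n ∈ S ∧ len n = L then
    D.coinLen (2 * nOf S len L + 2 + (ℓ (nOf S len L) + b (nOf S len L))) * (q.eval (nOf S len L) + 1) + b (nOf S len L) else 0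

/-- On a good parameter the budget is the intended one. [folklore] -/
theorem advCl_len_of_mem_good (D : RandAlg (List Bool) Bool) (ℓ b : ℕ → ℕ) {S : Set ℕ} {len : ℕ → ℕ} {n : ℕ}
    (hn : n ∈ good S len) : advCl q D ℓ b S len (len n) = D.coinLen (2 * n + 2 + (ℓ n + b n)) * (q.eval n + 1) + b n := by
  have hpre : ∃ m, m ∈ S ∧ len m = len n := ⟨n, hn.1, rfl⟩
  simp only [advCl, if_pos hpre, hn.2]

/-- The budget is polynomially bounded. [cite: AroraBarak2009, Def. 7.1] -/
theorem advCl_le (D : RandAlg (List Bool) Bool) {ℓ b : ℕ → ℕ} (S : Set ℕ) {len : ℕ → ℕ} (hlen : ∀ m, m ≤ len m)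
    {p P : Polynomial ℕ} (hp : ∀ k, D.coinLen k ≤ p.eval k) (hP : ∀ n, ℓ n ≤ P.eval n) (hb : ∀ n, b n ≤ q.eval n) (L : ℕ) :
    advCl q D ℓ b S len L ≤ (p.comp (2 * X + 2 + (P + q)) * (q + 1) + q).eval L := by
  by_cases hL : ∃ n, n ∈ S ∧ len n = L
  · simp only [advCl, if_pos hL]
    obtain ⟨-, hfix⟩ := nOf_spec hL
    have hnL : nOf S len L ≤ L := (hlen _).trans hfix.le
    have h1 : D.coinLen (2 * nOf S len L + 2 + (ℓ (nOf S len L) + b (nOf S len L))) ≤ (p.comp (2 * X + 2 + (P + q))).eval L := by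
      calc D.coinLen (2 * nOf S len L + 2 + (ℓ (nOf S len L) + b (nOf S len L))) ≤ p.eval (2 * nOf S len L + 2 + (ℓ (nOf S len L) + b (nOf S len L))) := hp _
        _ ≤ p.eval (2 * L + 2 + (P.eval L + q.eval L)) := polynomial_eval_mono p (by
            have := (hP (nOf S len L)).trans (polynomial_eval_mono P hnL)
            have := (hb (nOf S len L)).trans (polynomial_eval_mono q hnL); omega)
        _ = (p.comp (2 * X + 2 + (P + q))).eval L := by simp [Polynomial.eval_comp]
    have h2 : q.eval (nOf S len L) + 1 ≤ (q + 1).eval L := by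
      rw [eval_add, eval_one]; exact Nat.add_le_add_right (polynomial_eval_mono q hnL) 1
    have h3 : b (nOf S len L) ≤ q.eval L := (hb _).trans (polynomial_eval_mono q hnL)
    rw [eval_add, eval_mul]
    exact Nat.add_le_add (Nat.mul_le_mul h1 h2) h3
  · simp only [advCl, if_neg hL]
    exact Nat.zero_le _

end AdvApp

open AdvApp

/-- Non-negligible nonnegative sequences are frequently above an inverse polynomial. [folklore] -/
private theorem exists_frequently_ge_of_not_negligible_aa {u : ℕ → ℝ} (h0 : ∀ n, 0 ≤ u n)
    (h : ¬ SuperpolynomialDecay atTop (fun n : ℕ => (n : ℝ)) u) :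
    ∃ c : ℕ, ∃ᶠ n : ℕ in atTop, 1 / (n : ℝ) ^ c ≤ u n := by
  have h' := (isNegligible_iff_eventually_lt_of_nonneg h0).not.1 h
  push Not at h'
  obtain ⟨c, hc⟩ := h'
  exact ⟨c, by simpa [Filter.not_eventually, not_lt] using hc⟩

/-- **Appending `U_{b(n)}` for an arbitrary polynomially bounded `b` preserves computational indistinguishability.**
[cite: HastadImpagliazzoLevinLuby1999, Def. 2.3.3 and §3.1 (mildly non-uniform adversary); Goldreich2001, §3.2.3 (Thm. 3.2.6 proof, m = 2)] -/
theorem IsCompIndistinguishable.append_uniform_adv {X Y : Ensemble (List Bool)} {ℓ : ℕ → ℕ}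
    (h : IsCompIndistinguishable X Y) (hX : ∀ n, ∀ s ∈ (X n).support, s.length = ℓ n)
    (hY : ∀ n, ∀ s ∈ (Y n).support, s.length = ℓ n) (hℓ : ∃ P : Polynomial ℕ, ∀ n, ℓ n ≤ P.eval n)
    (q : Polynomial ℕ) {b : ℕ → ℕ} (hb : ∀ n, b n ≤ q.eval n) :
    IsCompIndistinguishable (fun n => (X n).bind fun α => (uniformBits (b n)).map fun s => α ++ s)
      (fun n => (Y n).bind fun α => (uniformBits (b n)).map fun s => α ++ s) := by
  intro D hD
  by_contra hneg
  set adv : ℕ → ℝ := distAdvantage D (fun n => (X n).bind fun α => (uniformBits (b n)).map fun s => α ++ s)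
    (fun n => (Y n).bind fun α => (uniformBits (b n)).map fun s => α ++ s) with hadv
  obtain ⟨c, hc⟩ := exists_frequently_ge_of_not_negligible_aa (fun n => distAdvantage_nonneg D _ _ n) hneg
  set S : Set ℕ := {n | 1 / (n : ℝ) ^ c ≤ adv n} with hS
  have hSinf : S.Infinite := Nat.frequently_atTop_iff_infinite.1 hc
  set len : ℕ → ℕ := fun n => 2 * n + 2 + ℓ n with hlen_def
  have hlen : ∀ m, m ≤ len m := fun m => by simp only [hlen_def]; omega
  have hgood : (good S len).Infinite := good_infinite hSinf hlen
  obtain ⟨P, hP⟩ := hℓ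
  obtain ⟨p, hp⟩ := hD.2
  have hPPT : IsPPT (red q D (advCl q D ℓ b S len)) encodeBool := isPPT_red q hD ⟨_, advCl_le q D S hlen hp hP hb⟩
  have hdec := h (red q D (advCl q D ℓ b S len)) hPPT
  have hagree : ∀ n ∈ good S len, distAdvantage (red q D (advCl q D ℓ b S len)) X Y n = adv n := by
    intro n hn
    have hcln : advCl q D ℓ b S len (2 * n + 2 + ℓ n) = D.coinLen (2 * n + 2 + (ℓ n + b n)) * (q.eval n + 1) + b n :=
      advCl_len_of_mem_good q D ℓ b hn
    simp only [hadv, distAdvantage]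
    rw [acceptPMF_red q D (X n) (hX n) (hb n) hcln, acceptPMF_red q D (Y n) (hY n) (hb n) hcln]
  have hev : ∀ᶠ n in atTop, distAdvantage (red q D (advCl q D ℓ b S len)) X Y n < 1 / (n : ℝ) ^ c :=
    (isNegligible_iff_eventually_lt_of_nonneg fun n => distAdvantage_nonneg _ _ _ n).1 hdec c
  have hfr : ∃ᶠ n in atTop, n ∈ good S len := Nat.frequently_atTop_iff_infinite.2 hgood
  obtain ⟨n, hnS', hlt⟩ := (hfr.and_eventually hev).exists
  have h1 : 1 / (n : ℝ) ^ c ≤ adv n := hnS'.1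
  rw [← hagree n hnS'] at h1
  exact absurd hlt (not_lt.2 h1)

end Literature.Computability.Cryptography
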